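import Summits.Ventures.PercRepro.C026ThreeFamily
import Summits.Ventures.PercRepro.C026SmallReduction

/-!
# The three-component family under reductions (p5, gen 14)

p6's reduction calculus (`Reduces3`, `C026At_of_reduces'`, the live graph `liveGraph` with
`law3_liveGraph`) composed with the three-component family theorem `c026_threeComponents`: C-026 holds at
`p` on every instance whose live graph is a three-component graph (every live non-mark reaches at most
three vertices through live edges between non-marks), and on every instance that series–parallel–pendant-
reduces to such an instance.
-/

namespace PercRepro

namespace MultiGraph

section ThreeReduction

variable {V E : Type} [Fintype E] [DecidableEq E]

/-- **C-026 at `p` on every three-component multigraph**, as a `C026At` statement. -/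
theorem C026At_of_threeComponents (G : MultiGraph V E) {p : E → ℝ} (hp : IsProb p) {a b c : V}
    (hG : G.IsThreeComponentGraph a b c) : G.C026At p a b c :=
  c026_threeComponents G hG p hp

open Classical in
/-- **C-026 at `p` when the live graph is a three-component graph**: `c026_threeComponents` on the live
graph, transported by `law3_liveGraph`. -/
theorem C026At_of_liveGraph_threeComponents (G : MultiGraph V E) {p : E → ℝ} (hp : IsProb p) (a b c : V)
    (h : (G.liveGraph p a b c).IsThreeComponentGraph ⟨a, Or.inl rfl⟩ ⟨b, Or.inr (Or.inl rfl)⟩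
      ⟨c, Or.inr (Or.inr (Or.inl rfl))⟩) : G.C026At p a b c := by
  unfold C026At
  rw [← G.law3_liveGraph p a b c]
  exact c026_threeComponents (G.liveGraph p a b c) h (fun e => p e.1) (fun e => hp e.1)

open Classical in
/-- **C-026 for every instance that series–parallel–pendant-reduces to a live three-component graph.** -/
theorem C026At_of_reduces_threeComponents {a b c : V} {G G' : MultiGraph V E} {p p' : E → ℝ}
    (hp : IsProb p) (h : Reduces3 a b c (G, p) (G', p'))
    (hG' : (G'.liveGraph p' a b c).IsThreeComponentGraph ⟨a, Or.inl rfl⟩ ⟨b, Or.inr (Or.inl rfl)⟩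
      ⟨c, Or.inr (Or.inr (Or.inl rfl))⟩) : G.C026At p a b c :=
  C026At_of_reduces' h (G'.C026At_of_liveGraph_threeComponents (h.isProb hp) a b c hG')

end ThreeReduction

end MultiGraph

end PercRepro
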